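import Summits.AtomisticToContinuum.BoseEinsteinCondensation.Theorems.SoloBlindSymmetrisedJensen

/-!
# Symmetrised Jensen for a finite product of Villain ratios (solo paper §13.9, Theorem 13.12, step (3))

The assembled form of the step replacing FS82's evenness argument [(2.79)–(2.80)]: on a probability
space carrying random phases `φ_i` (the renormalised charge ensemble `m_γ`), for finitely many
activities `0 ≤ z_i ≤ 1/7` and deterministic phases `θ_i`,

`exp(-Σ_i γ(z_i) θ_i²) ≤ ½ ( ∫ Π_i (1 + z_i cos(φ_i - θ_i))/(1 + z_i cos φ_i) dμ
                              + ∫ Π_i (1 + z_i cos(φ_i + θ_i))/(1 + z_i cos φ_i) dμ )`,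
`γ(z) = z/(2(1-z)) + 2z²/(1-z)²`,

with NO evenness assumption on the law of `φ`: the two integrands are the observable and its complex
conjugate, their Jensen exponents are `S ± T` with the same `S = -Σ γ θ²`, and `cosh T ≥ 1`
(`exp_le_half_integral_add_integral`).  Main statement: `exp_neg_sum_le_half_integral_prod_add`.
-/

namespace Summit.AtomisticToContinuum.BoseEinsteinCondensation.Theorems

open MeasureTheory

section VillainRatioBounds

/-- The Villain ratio lies in `[3/4, 4/3]` for `0 ≤ z ≤ 1/7`. -/
theorem villain_ratio_mem_Icc {z : ℝ} (hz0 : 0 ≤ z) (hz : z ≤ 1 / 7) (φ ψ : ℝ) :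
    (1 + z * Real.cos ψ) / (1 + z * Real.cos φ) ∈ Set.Icc (3 / 4 : ℝ) (4 / 3) := by
  have hD : 1 - z ≤ 1 + z * Real.cos φ := one_sub_le_one_add_mul_cos hz0 φ
  have hDpos : 0 < 1 + z * Real.cos φ := by linarith
  have hD' : 1 + z * Real.cos φ ≤ 1 + z := by nlinarith [Real.cos_le_one φ]
  have hN : 1 - z ≤ 1 + z * Real.cos ψ := one_sub_le_one_add_mul_cos hz0 ψ
  have hN' : 1 + z * Real.cos ψ ≤ 1 + z := by nlinarith [Real.cos_le_one ψ]
  constructor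
  · rw [le_div_iff₀ hDpos]; nlinarith
  · rw [div_le_iff₀ hDpos]; nlinarith

/-- Positivity of the Villain ratio. -/
theorem villain_ratio_pos {z : ℝ} (hz0 : 0 ≤ z) (hz : z ≤ 1 / 7) (φ ψ : ℝ) :
    0 < (1 + z * Real.cos ψ) / (1 + z * Real.cos φ) :=
  lt_of_lt_of_le (by norm_num) (villain_ratio_mem_Icc hz0 hz φ ψ).1

/-- `|log r| ≤ 1/3` on `[3/4, 4/3]` (from `1 - r⁻¹ ≤ log r ≤ r - 1`). -/
theorem log_mem_Icc_of_mem_Icc {r : ℝ} (hr : r ∈ Set.Icc (3 / 4 : ℝ) (4 / 3)) :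
    Real.log r ∈ Set.Icc (-(1 / 3) : ℝ) (1 / 3) := by
  obtain ⟨h1, h2⟩ := hr
  have hpos : 0 < r := by linarith
  constructor
  · have h := Real.one_sub_inv_le_log_of_pos hpos
    have hinv : r⁻¹ ≤ 4 / 3 := by
      rw [inv_le_comm₀ hpos (by norm_num)]
      linarith
    linarith
  · have h := Real.log_le_sub_one_of_pos hpos
    linarith

/-- The odd weight `w(φ) = z sin φ / (1 + z cos φ)` is bounded by `1/6` in absolute value. -/
theorem odd_weight_mem_Icc {z : ℝ} (hz0 : 0 ≤ z) (hz : z ≤ 1 / 7) (φ : ℝ) :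
    z * Real.sin φ / (1 + z * Real.cos φ) ∈ Set.Icc (-(1 / 6) : ℝ) (1 / 6) := by
  have hD : 1 - z ≤ 1 + z * Real.cos φ := one_sub_le_one_add_mul_cos hz0 φ
  have hDpos : 0 < 1 + z * Real.cos φ := by linarith
  have hs1 := Real.sin_le_one φ
  have hs2 := Real.neg_one_le_sin φ
  constructor
  · rw [le_div_iff₀ hDpos]; nlinarith
  · rw [div_le_iff₀ hDpos]; nlinarith

end VillainRatioBounds

section Product

variable {Ω : Type*} [MeasurableSpace Ω] {μ : Measure Ω} [IsProbabilityMeasure μ] {ι : Type*}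

/-- Measurability of a Villain ratio along a measurable random phase. -/
theorem measurable_villain_ratio (z θ : ℝ) {φ : Ω → ℝ} (hφ : Measurable φ) :
    Measurable fun ω => (1 + z * Real.cos (φ ω - θ)) / (1 + z * Real.cos (φ ω)) := by
  fun_prop

/-- Jensen exponent of a product of Villain ratios: `∫ log Π_i ratio_i ≥ -Σ γ(z_i) θ_i² + Σ sin θ_i ∫ w(φ_i)`,
together with the integrability facts needed downstream. -/
theorem integral_log_prod_villain_ratio_ge (s : Finset ι) {z θ : ι → ℝ}
    (hz0 : ∀ i, 0 ≤ z i) (hz : ∀ i, z i ≤ 1 / 7) {φ : ι → Ω → ℝ} (hφ : ∀ i, Measurable (φ i)) :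
    Integrable (fun ω => ∏ i ∈ s, (1 + z i * Real.cos (φ i ω - θ i)) / (1 + z i * Real.cos (φ i ω))) μ
    ∧ Integrable (fun ω => Real.log
        (∏ i ∈ s, (1 + z i * Real.cos (φ i ω - θ i)) / (1 + z i * Real.cos (φ i ω)))) μ
    ∧ -(∑ i ∈ s, (z i / (2 * (1 - z i)) + 2 * z i ^ 2 / (1 - z i) ^ 2) * θ i ^ 2)
        + ∑ i ∈ s, Real.sin (θ i) * ∫ ω, z i * Real.sin (φ i ω) / (1 + z i * Real.cos (φ i ω)) ∂μ
      ≤ ∫ ω, Real.log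
        (∏ i ∈ s, (1 + z i * Real.cos (φ i ω - θ i)) / (1 + z i * Real.cos (φ i ω))) ∂μ := by
  -- per-factor facts
  have hmeas : ∀ i, Measurable fun ω =>
      (1 + z i * Real.cos (φ i ω - θ i)) / (1 + z i * Real.cos (φ i ω)) :=
    fun i => measurable_villain_ratio (z i) (θ i) (hφ i)
  have hmem : ∀ i ω, (1 + z i * Real.cos (φ i ω - θ i)) / (1 + z i * Real.cos (φ i ω))
      ∈ Set.Icc (3 / 4 : ℝ) (4 / 3) := fun i ω => villain_ratio_mem_Icc (hz0 i) (hz i) _ _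
  have hpos : ∀ i ω, 0 < (1 + z i * Real.cos (φ i ω - θ i)) / (1 + z i * Real.cos (φ i ω)) :=
    fun i ω => villain_ratio_pos (hz0 i) (hz i) _ _
  -- log of the product = sum of logs, pointwise
  have hlogprod : ∀ ω, Real.log (∏ i ∈ s, (1 + z i * Real.cos (φ i ω - θ i)) / (1 + z i * Real.cos (φ i ω)))
      = ∑ i ∈ s, Real.log ((1 + z i * Real.cos (φ i ω - θ i)) / (1 + z i * Real.cos (φ i ω))) :=
    fun ω => Real.log_prod (fun i _ => (hpos i ω).ne')
  -- integrability of each log-factor and of each odd weight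
  have hlogi : ∀ i ∈ s, Integrable (fun ω => Real.log
      ((1 + z i * Real.cos (φ i ω - θ i)) / (1 + z i * Real.cos (φ i ω)))) μ := by
    intro i _
    refine Integrable.of_mem_Icc (-(1 / 3)) (1 / 3) (Real.measurable_log.comp (hmeas i)).aemeasurable
      (ae_of_all μ fun ω => ?_)
    exact log_mem_Icc_of_mem_Icc (hmem i ω)
  have hwi : ∀ i, Integrable (fun ω => z i * Real.sin (φ i ω) / (1 + z i * Real.cos (φ i ω))) μ := by
    intro i
    refine Integrable.of_mem_Icc (-(1 / 6)) (1 / 6) ?_ (ae_of_all μ fun ω => ?_)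
    · exact (by fun_prop : Measurable fun ω =>
        z i * Real.sin (φ i ω) / (1 + z i * Real.cos (φ i ω))).aemeasurable
    · exact odd_weight_mem_Icc (hz0 i) (hz i) (φ i ω)
  refine ⟨?_, ?_, ?_⟩
  · -- integrability of the product: bounded by (4/3)^card, measurable
    refine Integrable.of_mem_Icc 0 ((4 / 3 : ℝ) ^ s.card)
      (Finset.measurable_prod s fun i _ => hmeas i).aemeasurable (ae_of_all μ fun ω => ⟨?_, ?_⟩)
    · exact Finset.prod_nonneg fun i _ => (hpos i ω).le
    · calc ∏ i ∈ s, (1 + z i * Real.cos (φ i ω - θ i)) / (1 + z i * Real.cos (φ i ω))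
          ≤ ∏ _i ∈ s, (4 / 3 : ℝ) :=
            Finset.prod_le_prod (fun i _ => (hpos i ω).le) fun i _ => (hmem i ω).2
        _ = (4 / 3 : ℝ) ^ s.card := Finset.prod_const _
  · -- integrability of the log of the product
    have : (fun ω => Real.log (∏ i ∈ s, (1 + z i * Real.cos (φ i ω - θ i)) / (1 + z i * Real.cos (φ i ω))))
        = fun ω => ∑ i ∈ s, Real.log ((1 + z i * Real.cos (φ i ω - θ i)) / (1 + z i * Real.cos (φ i ω))) :=
      funext hlogprod
    rw [this]
    exact integrable_finsetSum s hlogi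
  · -- the Jensen exponent
    have hrew : ∫ ω, Real.log (∏ i ∈ s, (1 + z i * Real.cos (φ i ω - θ i)) / (1 + z i * Real.cos (φ i ω))) ∂μ
        = ∑ i ∈ s, ∫ ω, Real.log ((1 + z i * Real.cos (φ i ω - θ i)) / (1 + z i * Real.cos (φ i ω))) ∂μ := by
      rw [show (fun ω => Real.log (∏ i ∈ s, (1 + z i * Real.cos (φ i ω - θ i))
            / (1 + z i * Real.cos (φ i ω)))) = fun ω => ∑ i ∈ s, Real.log
            ((1 + z i * Real.cos (φ i ω - θ i)) / (1 + z i * Real.cos (φ i ω))) from funext hlogprod]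
      exact integral_finsetSum s hlogi
    rw [hrew, ← Finset.sum_neg_distrib, ← Finset.sum_add_distrib]
    refine Finset.sum_le_sum fun i hi => ?_
    -- per-factor Jensen exponent: ∫ (-γ θ² + sin θ · w) ≤ ∫ log ratio
    have hpt : ∀ ω, -(z i / (2 * (1 - z i)) + 2 * z i ^ 2 / (1 - z i) ^ 2) * θ i ^ 2
        + Real.sin (θ i) * (z i * Real.sin (φ i ω) / (1 + z i * Real.cos (φ i ω)))
        ≤ Real.log ((1 + z i * Real.cos (φ i ω - θ i)) / (1 + z i * Real.cos (φ i ω))) :=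
      fun ω => log_villain_ratio_lower_bound (hz0 i) (hz i) (φ i ω) (θ i)
    have hint : Integrable (fun ω => -(z i / (2 * (1 - z i)) + 2 * z i ^ 2 / (1 - z i) ^ 2) * θ i ^ 2
        + Real.sin (θ i) * (z i * Real.sin (φ i ω) / (1 + z i * Real.cos (φ i ω)))) μ :=
      (integrable_const _).add ((hwi i).const_mul _)
    have hmono := integral_mono hint (hlogi i hi) hpt
    have hlhs : ∫ ω, (-(z i / (2 * (1 - z i)) + 2 * z i ^ 2 / (1 - z i) ^ 2) * θ i ^ 2
        + Real.sin (θ i) * (z i * Real.sin (φ i ω) / (1 + z i * Real.cos (φ i ω)))) ∂μ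
        = -((z i / (2 * (1 - z i)) + 2 * z i ^ 2 / (1 - z i) ^ 2) * θ i ^ 2)
          + Real.sin (θ i) * ∫ ω, z i * Real.sin (φ i ω) / (1 + z i * Real.cos (φ i ω)) ∂μ := by
      rw [integral_add (integrable_const _) ((hwi i).const_mul _), integral_const_mul (Real.sin (θ i)),
        integral_const, probReal_univ, one_smul]
      ring
    linarith [hmono, hlhs]

/-- **Symmetrised Jensen for a product of Villain ratios (FS82 (2.79)–(2.80) without evenness).**
For `0 ≤ z_i ≤ 1/7`, deterministic `θ_i` and measurable random phases `φ_i` on a probability space,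
`exp(-Σ_i γ(z_i)θ_i²) ≤ ½(∫ Π_i ratio_i(θ) dμ + ∫ Π_i ratio_i(-θ) dμ)` with
`ratio_i(θ) = (1 + z_i cos(φ_i - θ_i))/(1 + z_i cos φ_i)` and `γ(z) = z/(2(1-z)) + 2z²/(1-z)²`;
the law of `φ` is arbitrary (no symmetry). -/
theorem exp_neg_sum_le_half_integral_prod_add (s : Finset ι) {z θ : ι → ℝ}
    (hz0 : ∀ i, 0 ≤ z i) (hz : ∀ i, z i ≤ 1 / 7) {φ : ι → Ω → ℝ} (hφ : ∀ i, Measurable (φ i)) :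
    Real.exp (-(∑ i ∈ s, (z i / (2 * (1 - z i)) + 2 * z i ^ 2 / (1 - z i) ^ 2) * θ i ^ 2))
      ≤ ((∫ ω, ∏ i ∈ s, (1 + z i * Real.cos (φ i ω - θ i)) / (1 + z i * Real.cos (φ i ω)) ∂μ)
        + ∫ ω, ∏ i ∈ s, (1 + z i * Real.cos (φ i ω + θ i)) / (1 + z i * Real.cos (φ i ω)) ∂μ) / 2 := by
  obtain ⟨hf, hlf, hSp⟩ := integral_log_prod_villain_ratio_ge (μ := μ) s (θ := θ) hz0 hz hφ
  obtain ⟨hg, hlg, hSm⟩ :=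
    integral_log_prod_villain_ratio_ge (μ := μ) s (θ := fun i => -θ i) hz0 hz hφ
  simp only [sub_neg_eq_add, Real.sin_neg, neg_mul, Finset.sum_neg_distrib, even_two.neg_pow]
    at hg hlg hSm
  have hf0 : ∀ ω, 0 < ∏ i ∈ s, (1 + z i * Real.cos (φ i ω - θ i)) / (1 + z i * Real.cos (φ i ω)) :=
    fun ω => Finset.prod_pos fun i _ => villain_ratio_pos (hz0 i) (hz i) _ _
  have hg0 : ∀ ω, 0 < ∏ i ∈ s, (1 + z i * Real.cos (φ i ω + θ i)) / (1 + z i * Real.cos (φ i ω)) :=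
    fun ω => Finset.prod_pos fun i _ => villain_ratio_pos (hz0 i) (hz i) _ _
  refine exp_le_half_integral_add_integral hf0 hg0 hf hg hlf hlg
    (T := ∑ i ∈ s, Real.sin (θ i) * ∫ ω, z i * Real.sin (φ i ω) / (1 + z i * Real.cos (φ i ω)) ∂μ)
    ?_ ?_
  · linarith
  · rw [sub_eq_add_neg]
    exact hSm

end Product

end Summit.AtomisticToContinuum.BoseEinsteinCondensation.Theorems
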